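import Literature.Computability.MetaComplexity.NWGenerator
import Literature.Computability.Complexity.UniformProbBlocks
import Literature.Computability.Complexity.MajorityEnumeration
import Literature.Computability.Complexity.KannanLanguage
import HarnessLib

/-!
# The Nisan–Wigderson generator on bit strings (designs in a product universe) and its predictor

Topic `Literature/Computability/MetaComplexity`. String layer over the typed combinatorics of
`NWGenerator.lean` (`nwGenerator`, `hybrid`, `nwPredictor`, `exists_nwPredictor_agreement_ge`), in
the product-universe representation of `NWLexicodeDesigns.lean` / `WeakDesigns.lean`: the universe is
`[ℓ] × [b]` laid out as the positions `k·b + v` of a seed `z ∈ {0,1}^{ℓ b}`, a block is the graph of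
a word `g : [ℓ] → [b]`, and the hard function `f : {0,1}^ℓ → {0,1}` is a truth table of length `2^ℓ`
read at the little-endian value of its argument (`bitsToNat`). This is the form in which Hirahara's
reconstruction (FOCS 2018 / ECCC TR18-138, Def. 4.5, Lemma 4.6) is recomputed by string machines:

* `NWStr.fAt f y`, `NWStr.resBits b g z` (`z|_{S_g}`), `NWStr.nwOut b f D z` (Def. 4.5:
  `NW^f(z) = f(z|_{S₁}) ⋯ f(z|_{S_m})`), `NWStr.overwrite` (the seed with the challenge placed on a
  block), `NWStr.hybQuery`, `NWStr.predBit` (Yao's predictor of Lemma 4.6: "set `z_{Sᵢ} := x` …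
  output `T(f(z_{S₁}) ⋯ f(z_{S_{i-1}}) c w_{i+1} ⋯ w_m) ⊕ c ⊕ 1`"), `NWStr.predTable` (its truth table);
* the bridge to the typed objects: `emb g` (the block embedding `k ↦ k·b + g k`), `fFun`,
  `ofFn_comp_emb`, `ofFn_nwGenerator`, `ofFn_extend_emb`, `ofFn_hybrid`, `nwPredictor_eq_predBit`;
* probabilities: `acceptProb_eq_uniformProb`, `acceptProbOn_eq_uniformProb` (the typed acceptance
  probabilities of a string test are `uniformProb`s), `agreement_eq_agreeCount_div` (the typed
  agreement of the predictor with `f` is the number of agreeing positions of the two truth tables);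
* **`NWStr.exists_predTable_agree`** — the string form of the NW reconstruction, existence half of
  Hirahara's Lemma 4.6: if the string test `S` accepts `NW^f(z)` with probability at least
  `Pr_y[y ∈ S] + δ`, then for some block `i < m`, seed `z₀ ∈ {0,1}^{ℓ b}` and bits `w ∈ {0,1}^m` the
  predictor's truth table agrees with `f` in at least `(1/2 + δ/m)·2^ℓ` positions.

## References

* S. Hirahara, *Non-black-box worst-case to average-case reductions within NP*, FOCS 2018; full
  version ECCC TR18-138 (rev. 1), Def. 4.5, Lemma 4.6 and its proof (pp. 15–16).
* N. Nisan, A. Wigderson, *Hardness vs randomness*, JCSS 49 (1994), Lemma 2.4.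
* S. Arora, B. Barak, *Computational Complexity: A Modern Approach*, CUP 2009, Lemma 20.15, Thm. 20.10.
-/

namespace Literature.Computability.MetaComplexity

open Finset Complexity

namespace NWStr

/-! ### The generator on strings -/

/-- The value `f(y)` of the function with truth table `f` (length `2^ℓ`, little-endian index) at
`y ∈ {0,1}^ℓ`. [cite: Hirahara2018, Def. 4.5 ("we identify `Enc(x) ∈ {0,1}^{2^ℓ}` with a function
on `ℓ`-bit inputs")] -/
def fAt (f y : List Bool) : Bool := f.getD (bitsToNat y) false

/-- The restriction `z|_{S_g}` of the seed to the block of the word `g` (bit `k` is the seed bit at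
position `k·b + g_k`). [cite: Hirahara2018, Def. 4.5 (`z_S`)] -/
def resBits (b : ℕ) (g : List ℕ) (z : List Bool) : List Bool := g.mapIdx fun k v => z.getD (k * b + v) false

/-- Length of a restriction: the length of the word. [folklore] -/
@[simp] theorem length_resBits (b : ℕ) (g : List ℕ) (z : List Bool) : (resBits b g z).length = g.length := by
  simp [resBits]

/-- Entries of a restriction. [folklore] -/
theorem getElem_resBits (b : ℕ) (g : List ℕ) (z : List Bool) {k : ℕ} (hk : k < (resBits b g z).length) :
    (resBits b g z)[k] = z.getD (k * b + g[k]'(by simpa using hk)) false := by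
  simp [resBits]

/-- **The Nisan–Wigderson generator on strings**: `NW^f_D(z) = f(z|_{S_{g₁}}) ⋯ f(z|_{S_{g_m}})` for a
design given as a list of words. [cite: Hirahara2018, Def. 4.5] -/
def nwOut (b : ℕ) (f : List Bool) (D : List (List ℕ)) (z : List Bool) : List Bool :=
  D.map fun g => fAt f (resBits b g z)

/-- The output has one bit per block. [folklore] -/
@[simp] theorem length_nwOut (b : ℕ) (f : List Bool) (D : List (List ℕ)) (z : List Bool) : (nwOut b f D z).length = D.length := by
  simp [nwOut]

/-- `nwOut` on a prefix of the design is the prefix of the output. [folklore] -/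
theorem nwOut_take (b : ℕ) (f : List Bool) (D : List (List ℕ)) (z : List Bool) (i : ℕ) :
    nwOut b f (D.take i) z = (nwOut b f D z).take i := by
  simp [nwOut, List.map_take]

/-! ### The typed objects -/

section Typed

variable {ℓ b m : ℕ}

/-- A word as a list of naturals. [folklore] -/
def wordList (g : Fin ℓ → Fin b) : List ℕ := List.ofFn fun k => (g k : ℕ)

/-- Length of `wordList`. [folklore] -/
@[simp] theorem length_wordList (g : Fin ℓ → Fin b) : (wordList g).length = ℓ := by simp [wordList]

/-- Entries of `wordList`. [folklore] -/
@[simp] theorem getElem_wordList (g : Fin ℓ → Fin b) {k : ℕ} (hk : k < (wordList g).length) :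
    (wordList g)[k] = (g ⟨k, by simpa using hk⟩ : ℕ) := by
  simp [wordList]

/-- Position arithmetic in the product universe: `k·b + v < ℓ·b` for `k < ℓ`, `v < b`. [folklore] -/
theorem pos_lt {k v : ℕ} (hk : k < ℓ) (hv : v < b) : k * b + v < ℓ * b := by
  calc k * b + v < k * b + b := Nat.add_lt_add_left hv _
    _ = (k + 1) * b := by ring
    _ ≤ ℓ * b := Nat.mul_le_mul_right _ hk

/-- **The block embedding** of a word: `k ↦ k·b + g k`, the graph of `g` laid out in `[ℓ b]`.
[cite: Hirahara2018, Lemma 4.4 (blocks: one element per sub-block of `[d]`)] -/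
def emb (g : Fin ℓ → Fin b) : Fin ℓ ↪ Fin (ℓ * b) :=
  ⟨fun k => ⟨(k : ℕ) * b + g k, pos_lt k.isLt (g k).isLt⟩, fun k k' h => by
    have h' : (k : ℕ) * b + g k = (k' : ℕ) * b + g k' := congrArg Fin.val h
    have hb : 0 < b := Fin.pos (g k)
    have h1 : ((k : ℕ) * b + g k) / b = k := by
      rw [Nat.add_comm, Nat.add_mul_div_right _ _ hb, Nat.div_eq_of_lt (g k).isLt, Nat.zero_add]
    have h2 : ((k' : ℕ) * b + g k') / b = k' := by
      rw [Nat.add_comm, Nat.add_mul_div_right _ _ hb, Nat.div_eq_of_lt (g k').isLt, Nat.zero_add]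
    exact Fin.ext (by rw [← h1, h', h2])⟩

/-- Values of the block embedding. [folklore] -/
@[simp] theorem emb_apply_val (g : Fin ℓ → Fin b) (k : Fin ℓ) : (emb g k : ℕ) = (k : ℕ) * b + g k := rfl

/-- The typed function of a truth table. [cite: Hirahara2018, Def. 4.5] -/
def fFun (ℓ : ℕ) (f : List Bool) : (Fin ℓ → Bool) → Bool := fun y => fAt f (List.ofFn y)

/-- Unfolding `fFun`. [folklore] -/
@[simp] theorem fFun_apply (f : List Bool) (y : Fin ℓ → Bool) : fFun ℓ f y = fAt f (List.ofFn y) := rfl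

/-- **The restriction along the embedding is `resBits` of the listed seed.** [cite: Hirahara2018, Def. 4.5] -/
theorem ofFn_comp_emb (g : Fin ℓ → Fin b) (z : Fin (ℓ * b) → Bool) :
    List.ofFn (z ∘ emb g) = resBits b (wordList g) (List.ofFn z) := by
  apply List.ext_getElem
  · simp
  · intro k h1 h2
    rw [List.getElem_ofFn, getElem_resBits]
    simp only [Function.comp_apply, getElem_wordList]
    rw [Kannan.getD_ofFn z (pos_lt (by simpa using h1) (g _).isLt)]
    rfl

/-- **The typed NW generator lists to `nwOut`.** [cite: Hirahara2018, Def. 4.5] -/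
theorem ofFn_nwGenerator (G : Fin m → (Fin ℓ → Fin b)) (f : List Bool) (z : Fin (ℓ * b) → Bool) :
    List.ofFn (nwGenerator (fun i => emb (G i)) (fFun ℓ f) z) = nwOut b f (List.ofFn fun i => wordList (G i)) (List.ofFn z) := by
  apply List.ext_getElem
  · simp
  · intro i h1 h2
    rw [List.getElem_ofFn]
    simp only [nwOut, List.getElem_map, List.getElem_ofFn, nwGenerator_apply, fFun_apply, ofFn_comp_emb]

/-! ### Acceptance probabilities of string tests -/

/-- The typed acceptance probability of the string test `y ↦ [y ∈ S]` on `m` bits is `uniformProb m S`.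
[folklore] -/
theorem acceptProb_eq_uniformProb (S : Set (List Bool)) [DecidablePred (· ∈ S)] :
    acceptProb (fun y : Fin m → Bool => decide (List.ofFn y ∈ S)) = uniformProb m S := by
  classical
  rw [acceptProb, uniformProb_eq_card_fun, Fintype.card_fun, Fintype.card_bool, Fintype.card_fin]
  push_cast
  congr 2
  exact Finset.card_bij (fun y _ => y) (fun y hy => by simpa using hy) (fun _ _ _ _ h => h)
    (fun y hy => ⟨y, by simpa using hy, rfl⟩)

/-- The typed acceptance probability of the string test on the NW generator is the `uniformProb` over
listed seeds of `nwOut ∈ S`. [cite: Hirahara2018, Lemma 4.6 (eq. (1))] -/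
theorem acceptProbOn_eq_uniformProb (S : Set (List Bool)) [DecidablePred (· ∈ S)] (G : Fin m → (Fin ℓ → Fin b)) (f : List Bool) :
    acceptProbOn (fun y : Fin m → Bool => decide (List.ofFn y ∈ S)) (nwGenerator (fun i => emb (G i)) (fFun ℓ f)) =
      uniformProb (ℓ * b) {z | nwOut b f (List.ofFn fun i => wordList (G i)) z ∈ S} := by
  classical
  rw [acceptProbOn, uniformProb_eq_card_fun, Fintype.card_fun, Fintype.card_bool, Fintype.card_fin]
  push_cast
  congr 2
  refine Finset.card_bij (fun z _ => z) (fun z hz => ?_) (fun _ _ _ _ h => h) (fun z hz => ⟨z, ?_, rfl⟩)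
  · simp only [mem_filter, mem_univ, true_and, decide_eq_true_eq] at hz
    simp only [mem_filter, mem_univ, true_and, Set.mem_setOf_eq, ← ofFn_nwGenerator]
    exact hz
  · simp only [mem_filter, mem_univ, true_and, Set.mem_setOf_eq, ← ofFn_nwGenerator] at hz
    simpa using hz

/-- **The advantage of a string test against `NW^f`**, in `uniformProb`s.
[cite: Hirahara2018, Lemma 4.6 (eq. (1))] -/
theorem advantage_eq_uniformProb_sub (S : Set (List Bool)) [DecidablePred (· ∈ S)] (G : Fin m → (Fin ℓ → Fin b)) (f : List Bool) :
    advantage (fun y : Fin m → Bool => decide (List.ofFn y ∈ S)) (nwGenerator (fun i => emb (G i)) (fFun ℓ f)) =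
      uniformProb (ℓ * b) {z | nwOut b f (List.ofFn fun i => wordList (G i)) z ∈ S} - uniformProb m S := by
  rw [advantage, acceptProbOn_eq_uniformProb, acceptProb_eq_uniformProb]

end Typed

/-! ### The predictor on strings -/

/-- **The seed with the challenge on a block**: `z` with the positions `k·b + gᵢ(k)` of the block of
`gᵢ` overwritten by the bits `a_k` of the challenge. [cite: Hirahara2018, Lemma 4.6 (proof: "set `z_{Sᵢ} := x`")] -/
def overwrite (b : ℕ) (gi : List ℕ) (z a : List Bool) : List Bool :=
  z.mapIdx fun p zb => if gi[p / b]? = some (p % b) then a.getD (p / b) false else zb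

/-- Overwriting keeps the length. [folklore] -/
@[simp] theorem length_overwrite (b : ℕ) (gi : List ℕ) (z a : List Bool) : (overwrite b gi z a).length = z.length := by
  simp [overwrite]

/-- Entries of the overwritten seed. [folklore] -/
theorem getD_overwrite (b : ℕ) (gi : List ℕ) (z a : List Bool) (p : ℕ) (hp : p < z.length) :
    (overwrite b gi z a).getD p false = if gi[p / b]? = some (p % b) then a.getD (p / b) false else z.getD p false := by
  rw [List.getD_eq_getElem _ _ (by simpa using hp), List.getD_eq_getElem _ _ hp]
  simp [overwrite]

/-- **The hybrid query** of the predictor for block `i` on challenge `a`: the real bits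
`f(z_a|_{S_j})`, `j < i`, of the overwritten seed `z_a`, followed by the bits `w_i, …, w_{m-1}`.
[cite: Hirahara2018, Lemma 4.6 (proof: the input `f(z_{S₁}) ⋯ f(z_{S_{i-1}}) c w_{i+1} ⋯ w_m` of `T_b`)] -/
def hybQuery (b : ℕ) (f : List Bool) (D : List (List ℕ)) (i : ℕ) (z w a : List Bool) : List Bool :=
  nwOut b f (D.take i) (overwrite b (D.getD i []) z a) ++ w.drop i

/-- **Yao's predictor on strings**: answer `w_i` if the hybrid query lies in `S`, `¬w_i` otherwise.
[cite: Hirahara2018, Lemma 4.6 (proof, the circuit `P^{T_b}`)] -/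
def predBit (S : Set (List Bool)) [DecidablePred (· ∈ S)] (b : ℕ) (f : List Bool) (D : List (List ℕ)) (i : ℕ)
    (z w a : List Bool) : Bool :=
  if hybQuery b f D i z w a ∈ S then w.getD i false else !(w.getD i false)

/-- **The predictor's truth table** (length `2^ℓ`, little-endian index). [cite: Hirahara2018, Lemma 4.6 (proof:
"evaluating the entire truth table of `P^{T_b}`")] -/
def predTable (S : Set (List Bool)) [DecidablePred (· ∈ S)] (ℓ b : ℕ) (f : List Bool) (D : List (List ℕ)) (i : ℕ)
    (z w : List Bool) : List Bool :=
  List.ofFn fun v : Fin (2 ^ ℓ) => predBit S b f D i z w (natBits ℓ v)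

/-- Length of the predictor's truth table. [folklore] -/
@[simp] theorem length_predTable (S : Set (List Bool)) [DecidablePred (· ∈ S)] (ℓ b : ℕ) (f : List Bool) (D : List (List ℕ))
    (i : ℕ) (z w : List Bool) : (predTable S ℓ b f D i z w).length = 2 ^ ℓ := by
  simp [predTable]

/-- **Agreeing positions** of two truth tables (counted over the positions of the first). [folklore] -/
def agreeCount (r f : List Bool) : ℕ := ((Finset.range r.length).filter fun p => r.getD p false = f.getD p false).card

section TypedPredictor

variable {ℓ b m : ℕ}

/-- **The completed seed lists to `overwrite`.** [cite: Hirahara2018, Lemma 4.6 (proof)] -/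
theorem ofFn_extend_emb (g : Fin ℓ → Fin b) (a : Fin ℓ → Bool) (z : Fin (ℓ * b) → Bool) :
    List.ofFn (Function.extend (emb g) a z) = overwrite b (wordList g) (List.ofFn z) (List.ofFn a) := by
  apply List.ext_getElem
  · simp
  · intro p h1 h2
    have hp : p < ℓ * b := by simpa using h1
    rw [List.getElem_ofFn, ← List.getD_eq_getElem _ false h2, getD_overwrite _ _ _ _ _ (by simpa using hp)]
    have hb : 0 < b := by
      rcases Nat.eq_zero_or_pos b with hb | hb
      · rw [hb, Nat.mul_zero] at hp; exact absurd hp (Nat.not_lt_zero _)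
      · exact hb
    have hk : p / b < ℓ := Nat.div_lt_of_lt_mul (by rwa [Nat.mul_comm] at hp)
    have hword : (wordList g)[p / b]? = some (g ⟨p / b, hk⟩ : ℕ) := by
      rw [List.getElem?_eq_getElem (by simpa using hk), getElem_wordList]
    rw [hword, Kannan.getD_ofFn z hp]
    by_cases hv : (g ⟨p / b, hk⟩ : ℕ) = p % b
    · -- `p` is the position of coordinate `p / b` of the block
      have hpe : emb g ⟨p / b, hk⟩ = ⟨p, hp⟩ := Fin.ext (by rw [emb_apply_val, hv]; exact Nat.div_add_mod' p b)
      rw [if_pos (by rw [hv]), ← hpe, (emb g).injective.extend_apply, Kannan.getD_ofFn a hk]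
    · have hne : ¬∃ k, emb g k = ⟨p, hp⟩ := by
        rintro ⟨k, hk'⟩
        apply hv
        have hval : (k : ℕ) * b + g k = p := congrArg Fin.val hk'
        have hkdiv : p / b = k := by
          rw [← hval, Nat.add_comm, Nat.add_mul_div_right _ _ hb, Nat.div_eq_of_lt (g k).isLt, Nat.zero_add]
        have hkmod : p % b = g k := by
          rw [← hval, Nat.add_comm, Nat.add_mul_mod_self_right, Nat.mod_eq_of_lt (g k).isLt]
        have hkk : (⟨p / b, hk⟩ : Fin ℓ) = k := Fin.ext hkdiv
        rw [hkk, hkmod]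
      rw [if_neg (fun h => hv (Option.some_injective _ h)), Function.extend_apply' _ _ _ hne]

/-- **The typed hybrid lists to `hybQuery`.** [cite: Hirahara2018, Lemma 4.6 (proof, hybrids `Hᵢ`)] -/
theorem ofFn_hybrid (G : Fin m → (Fin ℓ → Fin b)) (f : List Bool) (i : Fin m) (a : Fin ℓ → Bool) (z : Fin (ℓ * b) → Bool)
    (w : Fin m → Bool) :
    List.ofFn (hybrid (fun j => emb (G j)) (fFun ℓ f) i (Function.extend (emb (G i)) a z) w) =
      hybQuery b f (List.ofFn fun j => wordList (G j)) i (List.ofFn z) (List.ofFn w) (List.ofFn a) := by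
  have hD : (List.ofFn fun j => wordList (G j)).getD i [] = wordList (G i) := by
    rw [List.getD_eq_getElem _ _ (by simp), List.getElem_ofFn]
  apply List.ext_getElem
  · simp only [List.length_ofFn, hybQuery, List.length_append, length_nwOut, List.length_take, List.length_drop]
    rw [min_eq_left i.isLt.le]; omega
  · intro j h1 h2
    have hj : j < m := by simpa using h1
    rw [List.getElem_ofFn]
    simp only [hybrid]
    by_cases hji : j < i
    · rw [if_pos hji]
      simp only [hybQuery]
      rw [List.getElem_append_left (by simp only [length_nwOut, List.length_take, List.length_ofFn]; omega)]
      simp only [nwOut, List.getElem_map, List.getElem_take, List.getElem_ofFn, fFun_apply, hD, ← ofFn_extend_emb, ofFn_comp_emb]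
    · rw [if_neg hji]
      simp only [hybQuery]
      rw [List.getElem_append_right (by simp only [length_nwOut, List.length_take, List.length_ofFn]; omega)]
      simp only [length_nwOut, List.length_take, List.length_ofFn, min_eq_left i.isLt.le, List.getElem_drop, List.getElem_ofFn]
      congr 1
      exact Fin.ext (by simp; omega)

/-- **The typed NW predictor of a string test is `predBit`.** [cite: Hirahara2018, Lemma 4.6 (proof)] -/
theorem nwPredictor_eq_predBit (S : Set (List Bool)) [DecidablePred (· ∈ S)] (G : Fin m → (Fin ℓ → Fin b)) (f : List Bool)
    (i : Fin m) (z : Fin (ℓ * b) → Bool) (w : Fin m → Bool) (a : Fin ℓ → Bool) :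
    nwPredictor (fun j => emb (G j)) (fFun ℓ f) (fun y : Fin m → Bool => decide (List.ofFn y ∈ S)) i z w a =
      predBit S b f (List.ofFn fun j => wordList (G j)) i (List.ofFn z) (List.ofFn w) (List.ofFn a) := by
  simp only [nwPredictor, predictFn, decide_eq_true_eq, ofFn_hybrid, predBit, Kannan.getD_ofFn w i.isLt, Fin.eta]

/-- Reading the predictor's table at the value of a listed challenge. [folklore] -/
theorem getD_predTable_bitsToNat (S : Set (List Bool)) [DecidablePred (· ∈ S)] (f : List Bool) (D : List (List ℕ)) (i : ℕ)
    (z w : List Bool) (y : Fin ℓ → Bool) :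
    (predTable S ℓ b f D i z w).getD (bitsToNat (List.ofFn y)) false = predBit S b f D i z w (List.ofFn y) := by
  have hlt : bitsToNat (List.ofFn y) < 2 ^ ℓ := by simpa using bitsToNat_lt (List.ofFn y)
  rw [predTable, Kannan.getD_ofFn _ hlt]
  congr 1
  simpa using CoinEnum.natBits_bitsToNat (List.ofFn y)

/-- **The typed agreement is the number of agreeing table positions.** [cite: Hirahara2018, Lemma 4.6
("`Pr_x[P^{T_b}(x) = f(x)] ≥ 1/2 + δ/m`")] -/
theorem agreement_eq_agreeCount_div (S : Set (List Bool)) [DecidablePred (· ∈ S)] (G : Fin m → (Fin ℓ → Fin b)) (f : List Bool)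
    (i : Fin m) (z : Fin (ℓ * b) → Bool) (w : Fin m → Bool) :
    agreement (nwPredictor (fun j => emb (G j)) (fFun ℓ f) (fun y : Fin m → Bool => decide (List.ofFn y ∈ S)) i z w) (fFun ℓ f) =
      (agreeCount (predTable S ℓ b f (List.ofFn fun j => wordList (G j)) i (List.ofFn z) (List.ofFn w)) f : ℝ) / 2 ^ ℓ := by
  classical
  rw [agreement, Fintype.card_fun, Fintype.card_bool, Fintype.card_fin]
  push_cast
  congr 1
  norm_cast
  set T := predTable S ℓ b f (List.ofFn fun j => wordList (G j)) i (List.ofFn z) (List.ofFn w) with hT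
  unfold agreeCount
  rw [length_predTable]
  refine Finset.card_bij (fun y _ => bitsToNat (List.ofFn y)) (fun y hy => ?_) (fun y₁ _ y₂ _ h => ?_) (fun v hv => ?_)
  · simp only [mem_filter, mem_univ, true_and] at hy
    rw [mem_filter, mem_range]
    refine ⟨by simpa using bitsToNat_lt (List.ofFn y), ?_⟩
    rw [hT, getD_predTable_bitsToNat, ← nwPredictor_eq_predBit, hy, fFun_apply, fAt]
  · have h' := congrArg (natBits ℓ) h
    have e1 : natBits ℓ (bitsToNat (List.ofFn y₁)) = List.ofFn y₁ := by simpa using CoinEnum.natBits_bitsToNat (List.ofFn y₁)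
    have e2 : natBits ℓ (bitsToNat (List.ofFn y₂)) = List.ofFn y₂ := by simpa using CoinEnum.natBits_bitsToNat (List.ofFn y₂)
    rw [e1, e2] at h'
    exact List.ofFn_injective h'
  · rw [mem_filter, mem_range] at hv
    refine ⟨fun k => (natBits ℓ v).getD k false, ?_, ?_⟩
    · have hofFn : List.ofFn (fun k : Fin ℓ => (natBits ℓ v).getD k false) = natBits ℓ v := by
        apply List.ext_getElem
        · simp
        · intro k h1 h2
          rw [List.getElem_ofFn, List.getD_eq_getElem _ _ h2]
      simp only [mem_filter, mem_univ, true_and]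
      rw [nwPredictor_eq_predBit, fFun_apply, fAt, hofFn, bitsToNat_natBits hv.1]
      rw [hT, predTable, Kannan.getD_ofFn _ hv.1] at hv
      exact hv.2
    · have hofFn : List.ofFn (fun k : Fin ℓ => (natBits ℓ v).getD k false) = natBits ℓ v := by
        apply List.ext_getElem
        · simp
        · intro k h1 h2
          rw [List.getElem_ofFn, List.getD_eq_getElem _ _ h2]
      rw [hofFn, bitsToNat_natBits hv.1]

/-- **NW reconstruction on strings, existence half** (Hirahara 2018, Lemma 4.6, first part; Nisan–Wigderson
Lemma 2.4 with Yao's predictor): if the string test `S` accepts `NW^f_D(z)` (seed `z ∈ {0,1}^{ℓ b}`) with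
probability at least `Pr_{y ∈ {0,1}^m}[y ∈ S] + δ`, then for some block `i < m`, seed `z₀` and bits `w`
the predictor's truth table agrees with `f` in at least `(1/2 + δ/m)·2^ℓ` positions.
[cite: Hirahara2018, Lemma 4.6] [cite: NisanWigderson1994, Lemma 2.4] -/
theorem exists_predTable_agree (S : Set (List Bool)) [DecidablePred (· ∈ S)] (G : Fin m → (Fin ℓ → Fin b)) (f : List Bool)
    (hm : 0 < m) {δ : ℝ}
    (hadv : uniformProb m S + δ ≤ uniformProb (ℓ * b) {z | nwOut b f (List.ofFn fun j => wordList (G j)) z ∈ S}) :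
    ∃ (i : ℕ) (_ : i < m) (z w : List Bool), z.length = ℓ * b ∧ w.length = m ∧
      (1 / 2 + δ / m) * 2 ^ ℓ ≤ agreeCount (predTable S ℓ b f (List.ofFn fun j => wordList (G j)) i z w) f := by
  classical
  obtain ⟨i, z, w, h⟩ := exists_nwPredictor_agreement_ge (fun j => emb (G j)) (fFun ℓ f)
    (fun y : Fin m → Bool => decide (List.ofFn y ∈ S)) hm
  rw [advantage_eq_uniformProb_sub, agreement_eq_agreeCount_div] at h
  refine ⟨i, i.isLt, List.ofFn z, List.ofFn w, by simp, by simp, ?_⟩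
  have hδ : δ / m ≤ (uniformProb (ℓ * b) {z | nwOut b f (List.ofFn fun j => wordList (G j)) z ∈ S} - uniformProb m S) / m :=
    div_le_div_of_nonneg_right (by linarith) (Nat.cast_nonneg m)
  have h2 : (0 : ℝ) < 2 ^ ℓ := by positivity
  have h' : 1 / 2 + δ / m ≤ (agreeCount (predTable S ℓ b f (List.ofFn fun j => wordList (G j)) i (List.ofFn z) (List.ofFn w)) f : ℝ) / 2 ^ ℓ :=
    le_trans (by linarith) h
  rwa [le_div_iff₀ h2] at h'

end TypedPredictor

end NWStr

end Literature.Computability.MetaComplexity
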